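/-
Copyright (c) 2026 the pub-hodgecm-mathlib formalisation cell (harness21).  Prover seat hodgecm-mathlib-K2E3-p12 (g4), Track B «K2-LIT» ∕ h413
(`stmt-HodgeConjecture-24833`), line `K2_E3_EllipticInputs`, unit U12-d, §L (Φ′-a): THE EXCEPTIONAL ISOMORPHISM `𝔲(1,1) ≃ 𝔤𝔩₂(F)` — the Lie algebra of the hyperbolic
unitary plane `𝔲(σ, J₀)`, `J₀ = antidiag(1,1)`, is `𝔤𝔩₂` of the fixed field, compatibly with traces, discriminants and nilpotency.  2026-09-04.
-/
import Summits.HodgeConjecture.HodgeConjecture.Theorems.K2E3U2LieDiagonalCoordinates          -- ★ p856741 (K2E5-p12 g2): the quadratic frame `(σ, ι, λ, ρ)` and its lemmas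
import Summits.HodgeConjecture.HodgeConjecture.Theorems.K2E3U11RegularNilpotentOrbits          -- ★ p857063 (K2E5-p16 g3): `mem_lieOfForm_hyperbolic_iff`
import HarnessLib

/-!
# K2_E3 road (h413), §L — (Φ′-a) the transport `Φ : 𝔲(σ, J₀) ≃ 𝔤𝔩₂(F)` of the hyperbolic unitary Lie algebra to `𝔤𝔩₂` of the fixed field

Cell `pub/hodgecm-mathlib` (D-0151), Track B, seat K2E3-p12 (g4), §L line lead (MEMO v3 `K2/K2E3-p12/g4/MEMO-SL-LieCores-line.v3.K2E3-p12-g4.md` 76bc1f2b (T2);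
§L RULINGS #2).  `--supports stmt-HodgeConjecture-24833 --as helper`; THEOREMS ONLY (no definition ∕ instance ∕ notation ∕ named fact ∕ `sorry`); never imports `Cruxes/…/Lines`.
COUNT-NEUTRAL.

FRAME (★ p856741 `K2E3U2LieDiagonalCoordinates` §2, verbatim): `ι : F →+* E`, `σ : E →+* E` fixing `ι(F)` with `σλ = −λ`, `λ² = ι d`, and coordinates
`ρ = (re, im) : E → F × F`, `z = ι(re z) + λ·ι(im z)`.  `J₀ = !![0,1;1,0]` (★ p857063): `𝔲(σ,J₀) = {X | X₁₁ = −σX₀₀, X₀₁, X₁₀ skew}`.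
THE MAP (MEMO v3 (T2), `Φ(X_s + zλ·1) = D X_s D⁻¹ + z·1`, `D = diag(λ,1)`, written in coordinates):
  **`Φ X = !![re X₀₀ + im X₀₀, d·im X₀₁; im X₁₀, im X₀₀ − re X₀₀] ∈ 𝔤𝔩₂(F)`**, inverse `!![p,q;r,s] ↦ !![ι x₁ + λ ι x₂, λ ι(q∕d); λ ι r, −ι x₁ + λ ι x₂]`,
  `x₁ = (p − s)∕2`, `x₂ = (p + s)∕2`.
* §1 `entries_of_mem_lieOfForm_hyperbolic` (the four entries of `X ∈ 𝔲(σ,J₀)` in coordinates), `im_eq_of_trace_eq` (`im X₀₀ = tr X ∕ 2λ`).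
* §2 **`exists_lieTransport`**: `Φ` as an ADDITIVE HOMEOMORPHISM `↥(lieOfForm σ J₀) ≃+ Matrix (Fin 2) (Fin 2) F` with the displayed formula.
* §3 for any `Φ` with that formula: **`lieTransport_trace`** `tr(X·Y) = ι(tr(ΦX·ΦY) + (d−1)∕2 · tr ΦX · tr ΦY)` (the trace form transports to `tr` twisted on the centre only —
  invisible to distributions supported on the nilpotent cone), **`lieTransport_discr`** `disc χ_X = ι(disc χ_{ΦX})`, **`lieTransport_isNilpotent_iff`**, `lieTransport_eq_zero_iff`.
The `Ad`-EQUIVARIANCE «`Φ ∘ Ad(u) = Ad(g_u) ∘ Φ`, `{g_u} = G⁺ = det⁻¹(Nm Eˣ)`» (MEMO v3 (T3)) is FILE (Φ′-a2) `K2E3U11LieTransportEquivariance`.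
[PlatonovRapinchuk1994, §2.3 (forms of `SL₂`, `SU(1,1) ≅ SL₂`)]; [Knapp2002, I §8]; [HarishChandra1999AdmissibleDistributions, §4 p. 11 (the pairing `tr(XY)`)].

References: [PlatonovRapinchuk1994] V. Platonov, A. Rapinchuk, *Algebraic Groups and Number Theory* (1994), §2.3 · [Knapp2002] A. W. Knapp, *Lie Groups Beyond an
Introduction* (2002), I §8 · [HarishChandra1999AdmissibleDistributions] Harish-Chandra (DeBacker–Sally), AMS ULECT 16 (1999), §4 p. 11.
-/

set_option autoImplicit false
set_option linter.dupNamespace false   -- `Summit.HodgeConjecture.HodgeConjecture.…` (D-0017 nested layout; lakefile exemption for Summits)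

noncomputable section

open scoped Matrix MatrixGroups
open Literature.NumberTheory.Automorphic
open Summit.HodgeConjecture.HodgeConjecture.Cruxes.H413.K2E3LieUnitary (lieOfForm mem_lieOfForm_iff)
open Summit.HodgeConjecture.HodgeConjecture.Cruxes.H413.K2E3U2LieDiagonalCoordinates (ρ_add σ_eq_sub ρ_fst_eq_zero_of_skew eq_lam_mul_of_skew)
open Summit.HodgeConjecture.HodgeConjecture.Cruxes.H413.K2E3U11RegularNilpotentOrbits (mem_lieOfForm_hyperbolic_iff)

namespace Summit.HodgeConjecture.HodgeConjecture.Cruxes.H413.K2E3U11LieTransport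

/-! ## §1  Entries of `X ∈ 𝔲(σ, J₀)` in the quadratic coordinates -/

section Frame

variable {F E : Type*} [Field F] [Field E] (σ : E →+* E) (ι : F →+* E) (lam : E) (ρ : E → F × F)
  (hρ1 : ∀ z, ι (ρ z).1 + lam * ι (ρ z).2 = z) (hρ2 : ∀ r i, ρ (ι r + lam * ι i) = (r, i))
  (hσι : ∀ r, σ (ι r) = ι r) (hσl : σ lam = -lam) (h2 : (2 : E) ≠ 0)

include hρ1 hσι hσl h2 in
/-- **The four entries of `X ∈ 𝔲(σ, J₀)` in coordinates**: `X₀₀ = ι x₁ + λ ι x₂`, `X₁₁ = −ι x₁ + λ ι x₂`, `X₀₁ = λ ι β`, `X₁₀ = λ ι γ` with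
`(x₁, x₂) = ρ X₀₀`, `β = im X₀₁`, `γ = im X₁₀` (★ `mem_lieOfForm_hyperbolic_iff`: `X₁₁ = −σX₀₀`, off-diagonal entries skew). [cite: PlatonovRapinchuk1994, §2.3] -/
theorem exists_coords_of_mem_lieOfForm_hyperbolic {X : Matrix (Fin 2) (Fin 2) E} (hX : X ∈ lieOfForm σ !![(0 : E), 1; 1, 0]) :
    ∃ x₁ x₂ β γ : F, (ρ (X 0 0)).1 = x₁ ∧ (ρ (X 0 0)).2 = x₂ ∧ (ρ (X 0 1)).2 = β ∧ (ρ (X 1 0)).2 = γ ∧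
      X = !![ι x₁ + lam * ι x₂, lam * ι β; lam * ι γ, -ι x₁ + lam * ι x₂] := by
  obtain ⟨h10, h00, -, h01⟩ := (mem_lieOfForm_hyperbolic_iff σ X).1 hX
  refine ⟨_, _, _, _, rfl, rfl, rfl, rfl, ?_⟩
  have e00 : X 0 0 = ι (ρ (X 0 0)).1 + lam * ι (ρ (X 0 0)).2 := (hρ1 _).symm
  have e11 : X 1 1 = -ι (ρ (X 0 0)).1 + lam * ι (ρ (X 0 0)).2 := by
    have h : X 1 1 = -σ (X 0 0) := by rw [h00, neg_neg]
    have hs := σ_eq_sub σ ι lam ρ hρ1 hσι hσl (X 0 0)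
    rw [h, hs]; ring
  have e01 : X 0 1 = lam * ι (ρ (X 0 1)).2 := eq_lam_mul_of_skew σ ι lam ρ hρ1 hσι hσl h2 h01
  have e10 : X 1 0 = lam * ι (ρ (X 1 0)).2 := eq_lam_mul_of_skew σ ι lam ρ hρ1 hσι hσl h2 h10
  ext i j
  fin_cases i <;> fin_cases j
  · exact e00
  · exact e01
  · exact e10
  · exact e11

include hρ1 hσι hσl h2 in
/-- The trace of `X ∈ 𝔲(σ,J₀)` is `2λ·ι(im X₀₀)`. [cite: PlatonovRapinchuk1994, §2.3] -/
theorem trace_eq_of_mem_lieOfForm_hyperbolic {X : Matrix (Fin 2) (Fin 2) E} (hX : X ∈ lieOfForm σ !![(0 : E), 1; 1, 0]) :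
    Matrix.trace X = 2 * lam * ι (ρ (X 0 0)).2 := by
  obtain ⟨x₁, x₂, β, γ, -, hx₂, -, -, hXe⟩ := exists_coords_of_mem_lieOfForm_hyperbolic σ ι lam ρ hρ1 hσι hσl h2 hX
  rw [hx₂, hXe, Matrix.trace_fin_two]
  simp only [Matrix.of_apply, Matrix.cons_val', Matrix.cons_val_zero, Matrix.cons_val_one, Matrix.empty_val', Matrix.cons_val_fin_one]
  ring

include hρ1 hσι hσl h2 in
/-- Elements of `𝔲(σ,J₀)` with the same trace have the same `im X₀₀` (`λ ≠ 0`, `2 ≠ 0`, `ι` injective). [cite: PlatonovRapinchuk1994, §2.3] -/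
theorem im_eq_of_trace_eq (hl0 : lam ≠ 0) {X Y : Matrix (Fin 2) (Fin 2) E} (hX : X ∈ lieOfForm σ !![(0 : E), 1; 1, 0])
    (hY : Y ∈ lieOfForm σ !![(0 : E), 1; 1, 0]) (h : Matrix.trace Y = Matrix.trace X) : (ρ (Y 0 0)).2 = (ρ (X 0 0)).2 := by
  rw [trace_eq_of_mem_lieOfForm_hyperbolic σ ι lam ρ hρ1 hσι hσl h2 hX, trace_eq_of_mem_lieOfForm_hyperbolic σ ι lam ρ hρ1 hσι hσl h2 hY] at h
  have h' : ι (ρ (Y 0 0)).2 = ι (ρ (X 0 0)).2 := mul_left_cancel₀ (mul_ne_zero h2 hl0) h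
  exact ι.injective h'

end Frame

/-! ## §2  The additive homeomorphism `Φ : 𝔲(σ, J₀) ≃ 𝔤𝔩₂(F)` -/

section Transport

variable {F E : Type*} [Field F] [Field E] [TopologicalSpace F] [TopologicalSpace E] [IsTopologicalRing F] [IsTopologicalRing E]
  (σ : E →+* E) (ι : F →+* E) (hι : Continuous ι) (lam : E) (ρ : E → F × F) (hρc : Continuous ρ)
  (hρ1 : ∀ z, ι (ρ z).1 + lam * ι (ρ z).2 = z) (hρ2 : ∀ r i, ρ (ι r + lam * ι i) = (r, i))
  (hσι : ∀ r, σ (ι r) = ι r) (hσl : σ lam = -lam) (h2 : (2 : E) ≠ 0) (d : F) (hd : lam * lam = ι d) (hd0 : d ≠ 0)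

include hι hρc hρ1 hρ2 hσι hσl h2 hd0 in
/-- **THE TRANSPORT `Φ : 𝔲(σ, J₀) ≃ 𝔤𝔩₂(F)`** (additive homeomorphism): `Φ X = !![re X₀₀ + im X₀₀, d·im X₀₁; im X₁₀, im X₀₀ − re X₀₀]`, with inverse
`!![p,q;r,s] ↦ !![ι x₁ + λ ι x₂, λ ι(q∕d); λ ι r, −ι x₁ + λ ι x₂]`, `x₁ = (p−s)∕2`, `x₂ = (p+s)∕2`.  This is `X = X_s + x₂λ·1 ↦ D X_s D⁻¹ + x₂·1`, `D = diag(λ,1)`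
(MEMO v3 (T2)): `𝔰𝔲(1,1) ≅ 𝔰𝔩₂(F)` by `Ad(diag(λ,1))`, the centre `λF·1 ↦ F·1`. [cite: PlatonovRapinchuk1994, §2.3] [cite: Knapp2002, I §8] -/
theorem exists_lieTransport :
    ∃ Φ : ↥(lieOfForm σ !![(0 : E), 1; 1, 0]) ≃+ Matrix (Fin 2) (Fin 2) F, Continuous Φ ∧ Continuous Φ.symm ∧
      ∀ X : ↥(lieOfForm σ !![(0 : E), 1; 1, 0]),
        Φ X = !![(ρ (X.1 0 0)).1 + (ρ (X.1 0 0)).2, d * (ρ (X.1 0 1)).2; (ρ (X.1 1 0)).2, (ρ (X.1 0 0)).2 - (ρ (X.1 0 0)).1] := by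
  have h2F : (2 : F) ≠ 0 := fun h => h2 (by rw [← map_ofNat ι 2, h, map_zero])
  -- the inverse chart
  let g : Matrix (Fin 2) (Fin 2) F → Matrix (Fin 2) (Fin 2) E := fun M =>
    !![ι ((M 0 0 - M 1 1) / 2) + lam * ι ((M 0 0 + M 1 1) / 2), lam * ι (M 0 1 / d);
      lam * ι (M 1 0), -ι ((M 0 0 - M 1 1) / 2) + lam * ι ((M 0 0 + M 1 1) / 2)]
  have hg00 : ∀ M, g M 0 0 = ι ((M 0 0 - M 1 1) / 2) + lam * ι ((M 0 0 + M 1 1) / 2) := fun M => rfl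
  have hg01 : ∀ M, g M 0 1 = lam * ι (M 0 1 / d) := fun M => rfl
  have hg10 : ∀ M, g M 1 0 = lam * ι (M 1 0) := fun M => rfl
  have hg11 : ∀ M, g M 1 1 = -ι ((M 0 0 - M 1 1) / 2) + lam * ι ((M 0 0 + M 1 1) / 2) := fun M => rfl
  have hgmem : ∀ M, g M ∈ lieOfForm σ !![(0 : E), 1; 1, 0] := by
    intro M
    rw [mem_lieOfForm_hyperbolic_iff, hg00, hg01, hg10, hg11]
    refine ⟨?_, ?_, ?_, ?_⟩
    · rw [map_mul, hσl, hσι]; ring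
    · rw [map_add, map_mul, hσι, hσl, hσι]; ring
    · rw [map_add, map_neg, map_mul, hσι, hσl, hσι]; ring
    · rw [map_mul, hσl, hσι]; ring
  -- the chart
  let f : Matrix (Fin 2) (Fin 2) E → Matrix (Fin 2) (Fin 2) F := fun X =>
    !![(ρ (X 0 0)).1 + (ρ (X 0 0)).2, d * (ρ (X 0 1)).2; (ρ (X 1 0)).2, (ρ (X 0 0)).2 - (ρ (X 0 0)).1]
  have hf00 : ∀ X, f X 0 0 = (ρ (X 0 0)).1 + (ρ (X 0 0)).2 := fun X => rfl
  have hf01 : ∀ X, f X 0 1 = d * (ρ (X 0 1)).2 := fun X => rfl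
  have hf10 : ∀ X, f X 1 0 = (ρ (X 1 0)).2 := fun X => rfl
  have hf11 : ∀ X, f X 1 1 = (ρ (X 0 0)).2 - (ρ (X 0 0)).1 := fun X => rfl
  have hρlam : ∀ i : F, ρ (lam * ι i) = (0, i) := fun i => by
    have := hρ2 0 i; rwa [map_zero, zero_add] at this
  have hfg : ∀ M, f (g M) = M := by
    intro M
    ext i j
    fin_cases i <;> fin_cases j
    · show f (g M) 0 0 = M 0 0
      rw [hf00, hg00, hρ2]; field_simp; ring
    · show f (g M) 0 1 = M 0 1
      rw [hf01, hg01, hρlam]; field_simp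
    · show f (g M) 1 0 = M 1 0
      rw [hf10, hg10, hρlam]
    · show f (g M) 1 1 = M 1 1
      rw [hf11, hg00, hρ2]; field_simp; ring
  have hgf : ∀ X : ↥(lieOfForm σ !![(0 : E), 1; 1, 0]), g (f X.1) = X.1 := by
    intro X
    obtain ⟨x₁, x₂, β, γ, hx₁, hx₂, hβ, hγ, hXe⟩ := exists_coords_of_mem_lieOfForm_hyperbolic σ ι lam ρ hρ1 hσι hσl h2 X.2
    have hfX : f X.1 = !![x₁ + x₂, d * β; γ, x₂ - x₁] := by
      ext i j
      fin_cases i <;> fin_cases j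
      · show f X.1 0 0 = x₁ + x₂
        rw [hf00, hx₁, hx₂]
      · show f X.1 0 1 = d * β
        rw [hf01, hβ]
      · show f X.1 1 0 = γ
        rw [hf10, hγ]
      · show f X.1 1 1 = x₂ - x₁
        rw [hf11, hx₁, hx₂]
    have hx : (x₁ + x₂ - (x₂ - x₁)) / 2 = x₁ ∧ (x₁ + x₂ + (x₂ - x₁)) / 2 = x₂ := by
      constructor <;> · field_simp; ring
    rw [hfX, hXe]
    have e00 : (!![x₁ + x₂, d * β; γ, x₂ - x₁] : Matrix (Fin 2) (Fin 2) F) 0 0 = x₁ + x₂ := rfl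
    have e01 : (!![x₁ + x₂, d * β; γ, x₂ - x₁] : Matrix (Fin 2) (Fin 2) F) 0 1 = d * β := rfl
    have e10 : (!![x₁ + x₂, d * β; γ, x₂ - x₁] : Matrix (Fin 2) (Fin 2) F) 1 0 = γ := rfl
    have e11 : (!![x₁ + x₂, d * β; γ, x₂ - x₁] : Matrix (Fin 2) (Fin 2) F) 1 1 = x₂ - x₁ := rfl
    ext i j
    fin_cases i <;> fin_cases j
    · show g _ 0 0 = ι x₁ + lam * ι x₂
      rw [hg00, e00, e11, hx.1, hx.2]
    · show g _ 0 1 = lam * ι β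
      rw [hg01, e01, mul_div_cancel_left₀ _ hd0]
    · show g _ 1 0 = lam * ι γ
      rw [hg10, e10]
    · show g _ 1 1 = -ι x₁ + lam * ι x₂
      rw [hg11, e00, e11, hx.1, hx.2]
  let e' : Matrix (Fin 2) (Fin 2) F ≃+ ↥(lieOfForm σ !![(0 : E), 1; 1, 0]) :=
    { toFun := fun M => ⟨g M, hgmem M⟩
      invFun := fun X => f X.1
      left_inv := fun M => hfg M
      right_inv := fun X => Subtype.ext (hgf X)
      map_add' := fun M N => Subtype.ext (by
        show g (M + N) = g M + g N
        ext i j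
        fin_cases i <;> fin_cases j
        · show g (M + N) 0 0 = g M 0 0 + g N 0 0
          simp only [hg00, Matrix.add_apply]; rw [show (M 0 0 + N 0 0 - (M 1 1 + N 1 1)) / 2 = (M 0 0 - M 1 1) / 2 + (N 0 0 - N 1 1) / 2 by ring,
            show (M 0 0 + N 0 0 + (M 1 1 + N 1 1)) / 2 = (M 0 0 + M 1 1) / 2 + (N 0 0 + N 1 1) / 2 by ring, map_add, map_add]; ring
        · show g (M + N) 0 1 = g M 0 1 + g N 0 1
          simp only [hg01, Matrix.add_apply]; rw [add_div, map_add]; ring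
        · show g (M + N) 1 0 = g M 1 0 + g N 1 0
          simp only [hg10, Matrix.add_apply, map_add]; ring
        · show g (M + N) 1 1 = g M 1 1 + g N 1 1
          simp only [hg11, Matrix.add_apply]; rw [show (M 0 0 + N 0 0 - (M 1 1 + N 1 1)) / 2 = (M 0 0 - M 1 1) / 2 + (N 0 0 - N 1 1) / 2 by ring,
            show (M 0 0 + N 0 0 + (M 1 1 + N 1 1)) / 2 = (M 0 0 + M 1 1) / 2 + (N 0 0 + N 1 1) / 2 by ring, map_add, map_add]; ring) }
  -- continuity
  have hgc : Continuous g := by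
    have hm : ∀ i j : Fin 2, Continuous fun M : Matrix (Fin 2) (Fin 2) F => M i j := fun i j => continuous_id.matrix_elem i j
    refine continuous_matrix fun i j => ?_
    fin_cases i <;> fin_cases j
    · exact (hι.comp (((hm 0 0).sub (hm 1 1)).div_const _)).add (continuous_const.mul (hι.comp (((hm 0 0).add (hm 1 1)).div_const _)))
    · exact continuous_const.mul (hι.comp ((hm 0 1).div_const _))
    · exact continuous_const.mul (hι.comp (hm 1 0))
    · exact (hι.comp (((hm 0 0).sub (hm 1 1)).div_const _)).neg.add (continuous_const.mul (hι.comp (((hm 0 0).add (hm 1 1)).div_const _)))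
  have hfc : Continuous fun X : ↥(lieOfForm σ !![(0 : E), 1; 1, 0]) => f X.1 := by
    have hv : Continuous fun X : ↥(lieOfForm σ !![(0 : E), 1; 1, 0]) => (X.1 : Matrix (Fin 2) (Fin 2) E) := continuous_subtype_val
    have hr : ∀ i j : Fin 2, Continuous fun X : ↥(lieOfForm σ !![(0 : E), 1; 1, 0]) => ρ (X.1 i j) := fun i j => hρc.comp (hv.matrix_elem i j)
    refine continuous_matrix fun i j => ?_
    fin_cases i <;> fin_cases j
    · exact (continuous_fst.comp (hr 0 0)).add (continuous_snd.comp (hr 0 0))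
    · exact continuous_const.mul (continuous_snd.comp (hr 0 1))
    · exact continuous_snd.comp (hr 1 0)
    · exact (continuous_snd.comp (hr 0 0)).sub (continuous_fst.comp (hr 0 0))
  exact ⟨e'.symm, hfc, hgc.subtype_mk _, fun X => rfl⟩

end Transport

/-! ## §3  What `Φ` transports: the trace form, the discriminant, the nilpotent cone -/

section Properties

variable {F E : Type*} [Field F] [Field E] (σ : E →+* E) (ι : F →+* E) (lam : E) (ρ : E → F × F)
  (hρ1 : ∀ z, ι (ρ z).1 + lam * ι (ρ z).2 = z) (hρ2 : ∀ r i, ρ (ι r + lam * ι i) = (r, i))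
  (hσι : ∀ r, σ (ι r) = ι r) (hσl : σ lam = -lam) (h2 : (2 : E) ≠ 0) (d : F) (hd : lam * lam = ι d)
  (Φ : ↥(lieOfForm σ !![(0 : E), 1; 1, 0]) → Matrix (Fin 2) (Fin 2) F)
  (hΦ : ∀ X : ↥(lieOfForm σ !![(0 : E), 1; 1, 0]),
    Φ X = !![(ρ (X.1 0 0)).1 + (ρ (X.1 0 0)).2, d * (ρ (X.1 0 1)).2; (ρ (X.1 1 0)).2, (ρ (X.1 0 0)).2 - (ρ (X.1 0 0)).1])

include hρ1 hσι hσl h2 hΦ in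
/-- `Φ X` in the coordinates of ★ `exists_coords_of_mem_lieOfForm_hyperbolic`. [cite: PlatonovRapinchuk1994, §2.3] -/
theorem exists_coords (X : ↥(lieOfForm σ !![(0 : E), 1; 1, 0])) :
    ∃ x₁ x₂ β γ : F, (ρ (X.1 0 0)).2 = x₂ ∧ X.1 = !![ι x₁ + lam * ι x₂, lam * ι β; lam * ι γ, -ι x₁ + lam * ι x₂] ∧
      Φ X = !![x₁ + x₂, d * β; γ, x₂ - x₁] := by
  obtain ⟨x₁, x₂, β, γ, hx₁, hx₂, hβ, hγ, hXe⟩ := exists_coords_of_mem_lieOfForm_hyperbolic σ ι lam ρ hρ1 hσι hσl h2 X.2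
  refine ⟨x₁, x₂, β, γ, hx₂, hXe, ?_⟩
  rw [hΦ X, hx₁, hx₂, hβ, hγ]

include hρ1 hσι hσl h2 hd hΦ in
/-- **The trace form transports to the trace form twisted on the centre**: `2·tr(X·Y) = ι(2·tr(ΦX·ΦY) + (d − 1)·tr ΦX·tr ΦY)` — on the traceless part
(where the nilpotent cone lives) it is `tr` on the nose. [cite: HarishChandra1999AdmissibleDistributions, §4 p. 11] [cite: PlatonovRapinchuk1994, §2.3] -/
theorem lieTransport_trace (X Y : ↥(lieOfForm σ !![(0 : E), 1; 1, 0])) :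
    2 * Matrix.trace (X.1 * Y.1) = ι (2 * Matrix.trace (Φ X * Φ Y) + (d - 1) * (Matrix.trace (Φ X) * Matrix.trace (Φ Y))) := by
  obtain ⟨x₁, x₂, β, γ, -, hXe, hΦX⟩ := exists_coords σ ι lam ρ hρ1 hσι hσl h2 d Φ hΦ X
  obtain ⟨y₁, y₂, β', γ', -, hYe, hΦY⟩ := exists_coords σ ι lam ρ hρ1 hσι hσl h2 d Φ hΦ Y
  rw [hXe, hYe, hΦX, hΦY]
  simp only [Matrix.trace_fin_two, Matrix.mul_apply, Fin.sum_univ_two, Matrix.of_apply, Matrix.cons_val', Matrix.cons_val_zero, Matrix.cons_val_one,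
    Matrix.empty_val', Matrix.cons_val_fin_one, map_add, map_mul, map_sub, map_ofNat, map_one]
  linear_combination (4 * ι x₂ * ι y₂ + 2 * (ι β * ι γ' + ι γ * ι β')) * hd

include hρ1 hσι hσl h2 hΦ in
/-- **Traces**: `tr X = λ·ι(tr ΦX)`. [cite: PlatonovRapinchuk1994, §2.3] -/
theorem lieTransport_trace_one (X : ↥(lieOfForm σ !![(0 : E), 1; 1, 0])) : Matrix.trace X.1 = lam * ι (Matrix.trace (Φ X)) := by
  obtain ⟨x₁, x₂, β, γ, -, hXe, hΦX⟩ := exists_coords σ ι lam ρ hρ1 hσι hσl h2 d Φ hΦ X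
  rw [hXe, hΦX, Matrix.trace_fin_two, Matrix.trace_fin_two]
  simp only [Matrix.of_apply, Matrix.cons_val', Matrix.cons_val_zero, Matrix.cons_val_one, Matrix.empty_val', Matrix.cons_val_fin_one, map_add, map_sub]
  ring

include hρ1 hσι hσl h2 hd hΦ in
/-- **Determinants**: `det X = ι(det ΦX) + (ι d − 1)·(ι(im X₀₀))²` (the centre is rescaled by `λ`; on the traceless part `det` is transported on the nose).
[cite: PlatonovRapinchuk1994, §2.3] -/
theorem lieTransport_det (X : ↥(lieOfForm σ !![(0 : E), 1; 1, 0])) : X.1.det = ι ((Φ X).det) + (ι d - 1) * ι (ρ (X.1 0 0)).2 ^ 2 := by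
  obtain ⟨x₁, x₂, β, γ, hx₂, hXe, hΦX⟩ := exists_coords σ ι lam ρ hρ1 hσι hσl h2 d Φ hΦ X
  rw [hx₂, hXe, hΦX, Matrix.det_fin_two, Matrix.det_fin_two]
  simp only [Matrix.of_apply, Matrix.cons_val', Matrix.cons_val_zero, Matrix.cons_val_one, Matrix.empty_val', Matrix.cons_val_fin_one, map_add, map_mul, map_sub]
  linear_combination (ι x₂ ^ 2 - ι β * ι γ) * hd

include hρ1 hσι hσl h2 hd hΦ in
/-- **The discriminant is transported on the nose**: `disc χ_X = ι(disc χ_{ΦX})` (`Φ` is `Ad(D)` on the traceless part and adds a scalar, both of which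
preserve the discriminant). [cite: HarishChandra1999AdmissibleDistributions, Thm. 7.5 p. 51] [cite: PlatonovRapinchuk1994, §2.3] -/
theorem lieTransport_discr (X : ↥(lieOfForm σ !![(0 : E), 1; 1, 0])) : X.1.charpoly.discr = ι ((Φ X).charpoly.discr) := by
  have hX : X.1.charpoly.discr = X.1.trace ^ 2 - 4 * X.1.det := Matrix.discr_fin_two X.1
  have hΦX' : (Φ X).charpoly.discr = (Φ X).trace ^ 2 - 4 * (Φ X).det := Matrix.discr_fin_two (Φ X)
  obtain ⟨x₁, x₂, β, γ, hx₂, hXe, hΦX⟩ := exists_coords σ ι lam ρ hρ1 hσι hσl h2 d Φ hΦ X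
  rw [hX, hΦX', hXe, hΦX]
  simp only [Matrix.trace_fin_two, Matrix.det_fin_two, Matrix.of_apply, Matrix.cons_val', Matrix.cons_val_zero, Matrix.cons_val_one, Matrix.empty_val',
    Matrix.cons_val_fin_one, map_add, map_mul, map_sub, map_pow, map_ofNat]
  linear_combination (4 * ι β * ι γ) * hd

omit [Field E] in
/-- A `2 × 2` matrix over a field is nilpotent iff its trace and determinant vanish (Cayley–Hamilton `A² = tr A·A − det A·1`). [folklore] -/
theorem isNilpotent_iff_trace_eq_zero_and_det_eq_zero {K : Type*} [Field K] (A : Matrix (Fin 2) (Fin 2) K) :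
    IsNilpotent A ↔ Matrix.trace A = 0 ∧ A.det = 0 := by
  have hCH : A * A = Matrix.trace A • A - A.det • (1 : Matrix (Fin 2) (Fin 2) K) := by
    ext i j
    fin_cases i <;> fin_cases j <;>
      simp [Matrix.mul_apply, Fin.sum_univ_two, Matrix.trace_fin_two, Matrix.det_fin_two] <;> ring
  constructor
  · intro hA
    have hsq : A * A = 0 := by
      have h1 : A.charpoly = Polynomial.X ^ 2 := by
        have h := (Matrix.isNilpotent_charpoly_sub_pow_of_isNilpotent hA).eq_zero
        rw [sub_eq_zero] at h
        simpa using h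
      have h2' := Matrix.aeval_self_charpoly A
      rwa [h1, map_pow, Polynomial.aeval_X, pow_two] at h2'
    have hdet : A.det = 0 := by
      have := congrArg Matrix.det hsq
      rw [Matrix.det_mul, Matrix.det_zero] at this
      exact mul_self_eq_zero.1 this
    refine ⟨?_, hdet⟩
    rw [hsq, hdet, zero_smul, sub_zero] at hCH
    rcases smul_eq_zero.1 hCH.symm with h | h
    · exact h
    · rw [h, Matrix.trace_zero]
  · rintro ⟨htr, hdet⟩
    refine ⟨2, ?_⟩
    rw [pow_two, hCH, htr, hdet, zero_smul, zero_smul, sub_zero]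

include hρ1 hσι hσl h2 hd hΦ in
/-- **The nilpotent cone is transported on the nose**: `X` nilpotent `↔ ΦX` nilpotent (`λ ≠ 0`). [cite: HarishChandra1999AdmissibleDistributions, §3 p. 8] -/
theorem lieTransport_isNilpotent_iff (hl0 : lam ≠ 0) (X : ↥(lieOfForm σ !![(0 : E), 1; 1, 0])) : IsNilpotent X.1 ↔ IsNilpotent (Φ X) := by
  obtain ⟨x₁, x₂, β, γ, -, hXe, hΦX⟩ := exists_coords σ ι lam ρ hρ1 hσι hσl h2 d Φ hΦ X
  rw [isNilpotent_iff_trace_eq_zero_and_det_eq_zero, isNilpotent_iff_trace_eq_zero_and_det_eq_zero, hXe, hΦX]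
  simp only [Matrix.trace_fin_two, Matrix.det_fin_two, Matrix.of_apply, Matrix.cons_val', Matrix.cons_val_zero, Matrix.cons_val_one, Matrix.empty_val',
    Matrix.cons_val_fin_one]
  have h2F : (2 : F) ≠ 0 := fun h => h2 (by rw [← map_ofNat ι 2, h, map_zero])
  constructor
  · rintro ⟨htr, hdet⟩
    have hx₂E : (2 * lam) * ι x₂ = 0 := by linear_combination htr
    have hx₂ : x₂ = 0 := (map_eq_zero_iff ι ι.injective).1 ((mul_eq_zero.1 hx₂E).resolve_left (mul_ne_zero h2 hl0))
    refine ⟨by rw [hx₂]; ring, ?_⟩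
    have hE : ι ((x₁ + x₂) * (x₂ - x₁) - d * β * γ) = 0 := by
      rw [map_sub, map_mul, map_mul, map_add, map_sub, map_mul, hx₂, map_zero]
      rw [hx₂, map_zero] at hdet
      linear_combination hdet + (ι β * ι γ) * hd
    exact (map_eq_zero_iff ι ι.injective).1 hE
  · rintro ⟨htr, hdet⟩
    have hx₂ : x₂ = 0 := by
      have : (2 : F) * x₂ = 0 := by linear_combination htr
      exact (mul_eq_zero.1 this).resolve_left h2F
    rw [hx₂] at hdet ⊢
    have hdet' : ι (x₁ * x₁ + d * β * γ) = 0 := by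
      have : x₁ * x₁ + d * β * γ = 0 := by linear_combination -hdet
      rw [this, map_zero]
    rw [map_add, map_mul, map_mul, map_mul] at hdet'
    constructor
    · rw [map_zero]; ring
    · rw [map_zero]; linear_combination -hdet' - (ι β * ι γ) * hd

include hρ1 hσι hσl h2 hd hΦ in
/-- `ΦX = 0 ↔ X = 0` (`λ ≠ 0`). [cite: PlatonovRapinchuk1994, §2.3] -/
theorem lieTransport_eq_zero_iff (hl0 : lam ≠ 0) (X : ↥(lieOfForm σ !![(0 : E), 1; 1, 0])) : Φ X = 0 ↔ X.1 = 0 := by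
  have h2F : (2 : F) ≠ 0 := fun h => h2 (by rw [← map_ofNat ι 2, h, map_zero])
  have hd0 : d ≠ 0 := fun h => by rw [h, map_zero] at hd; exact mul_ne_zero hl0 hl0 hd
  obtain ⟨x₁, x₂, β, γ, -, hXe, hΦX⟩ := exists_coords σ ι lam ρ hρ1 hσι hσl h2 d Φ hΦ X
  rw [hXe, hΦX]
  constructor
  · intro h
    have h00 := congr_fun (congr_fun h 0) 0
    have h01 := congr_fun (congr_fun h 0) 1
    have h10 := congr_fun (congr_fun h 1) 0
    have h11 := congr_fun (congr_fun h 1) 1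
    simp only [Matrix.of_apply, Matrix.cons_val', Matrix.cons_val_zero, Matrix.cons_val_one, Matrix.empty_val', Matrix.cons_val_fin_one, Matrix.zero_apply] at h00 h01 h10 h11
    have hx2 : x₂ = 0 := by
      have : (2 : F) * x₂ = 0 := by linear_combination h00 + h11
      exact (mul_eq_zero.1 this).resolve_left h2F
    have hx1 : x₁ = 0 := by linear_combination h00 - hx2
    have hβ : β = 0 := (mul_eq_zero.1 h01).resolve_left hd0
    rw [hx1, hx2, hβ, h10]
    ext i j
    fin_cases i <;> fin_cases j <;> simp
  · intro h
    have h00 := congr_fun (congr_fun h 0) 0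
    have h01 := congr_fun (congr_fun h 0) 1
    have h10 := congr_fun (congr_fun h 1) 0
    have h11 := congr_fun (congr_fun h 1) 1
    simp only [Matrix.of_apply, Matrix.cons_val', Matrix.cons_val_zero, Matrix.cons_val_one, Matrix.empty_val', Matrix.cons_val_fin_one, Matrix.zero_apply] at h00 h01 h10 h11
    have hx₂E : (2 * lam) * ι x₂ = 0 := by linear_combination h00 + h11
    have hx₂ : x₂ = 0 := (map_eq_zero_iff ι ι.injective).1 ((mul_eq_zero.1 hx₂E).resolve_left (mul_ne_zero h2 hl0))
    have hx₁E : (2 : E) * ι x₁ = 0 := by linear_combination h00 - h11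
    have hx₁ : x₁ = 0 := (map_eq_zero_iff ι ι.injective).1 ((mul_eq_zero.1 hx₁E).resolve_left h2)
    have hβ : β = 0 := (map_eq_zero_iff ι ι.injective).1 ((mul_eq_zero.1 h01).resolve_left hl0)
    have hγ : γ = 0 := (map_eq_zero_iff ι ι.injective).1 ((mul_eq_zero.1 h10).resolve_left hl0)
    rw [hx₁, hx₂, hβ, hγ]
    ext i j
    fin_cases i <;> fin_cases j <;> simp

end Properties

end Summit.HodgeConjecture.HodgeConjecture.Cruxes.H413.K2E3U11LieTransport
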